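import Mathlib
import HarnessLib
import Summits.HubbardSuperconductivity.HubbardSuperconductivity.Theorems.KLProgrammeKLRegimeEngineV17F2ClosersVGQLad
import Summits.HubbardSuperconductivity.HubbardSuperconductivity.Theorems.KLProgrammeKLRegimeEnginePairTransferMemberTowerSigmaData

/-!
# K3 ENGINE (stmt-HubbardSuperconductivity-20437 `KLRegimeEngineV17F2`, V2 registration 27cd7ed0f55f17c0), row (c) `stub_engine_step_values`:
# binder #8 `hexLadPkg` FROM hsucc-SHAPED ROWS with the Σ-class in (C′) DATA FORM — **`EngineV8.rowC_hexLadPkg_of_towerSigmaData hexLadMD : <hexLadPkg VERBATIM>`**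
# (cell gate-hubbard-kl, seat hubbard-kl-k3c1-p1 g27, technique «composed-map remainder propagation»; composes `KLRegimeSplit.klmt_htower_family_sigmaData`
# (…PairTransferMemberTowerSigmaData) under row (c)'s prefix; sequel of `rowC_hexLadPkg_of_towerValues` (…VGQLadTowerMV, g26, ★ v19/v20 binder #8 `hexLadMV`))

WHAT.  **`hexLadMD`** = `hexLadMV` with the 6–2 / born Σ-class VALUE row `‖Σ_pΣ_σ(Ẇ_tβL²ĝ)(Φβ L²ĝ)·V6(p,σ;y,Qm−y,Qm−x,x)·Sg(p,σ)‖ ≤ RS x y` REPLACED, per `(t, x, y)`, by the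
self-energy line's LOCALISATION DATA `∃ (T : Fin 2 → ℂ) (Sg₀ zω ze : ℂ) (δ ≥ 0)` with the row `Ẇ_t(p) ≠ 0 → ‖V6(…)·Sg(p,σ) − T σ·(Sg₀ + zω·iω_p + ze·e_{K_{n′+1}}(p))‖ ≤ δ`
((Σλ1)/(Σλ2) currency of cure (C′), E1: one-shot residual local part `Sg₀`, wave-function / velocity renormalisation `zω, ze`, Taylor + tree remainder `δ`) and ONE arithmetic
domination row «k3c2-p2's O5c majorant (`klok_localisedBorn_row_full_le`: DOS-slope × ‖ΣT‖ + rotation × ‖ΣT·Sg₀‖ + 2¹⁰·15367·δ), with the radial profile constants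
(`Λ(t)/2`, `8/Λₙ′₊₁`, `(2B₂+72)/Λₙ′₊₁³`), the chart `B = bandBounds(−6/5,−1/10)` and the frame size `Af = 2Gfr₀|U| + 2Gfr₁U² + Gfr₂·c/log 4` WRITTEN OUT, `≤ (Λₙ′−Λₙ′₊₁)(βL²)⁻³·RS x y`».
`RS` stays the producer's `t`-uniform Σ-slot in the budget `J = (Λd)(½RH + (βL²)⁻³(RP + RQ + 2RS)) + RL`; every other row (`∃ m` ×3, `Z ≠ 0`, the twelve family pins, a priori ×2,
(F)(i) `η` + cap, smallness, `RH RP RQ RL`, consumer rows at `transferBarRelIdx … n′ n′ Qm` and the (E2-F2) slot line) is `hexLadMV`'s VERBATIM.  Inside, the C4a chart / frame /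
Matsubara hypotheses of the producer are DISCHARGED under row (c)'s doors (`rowC_frameWindow`, `frameWindow_thresholds_of_doors`, `frameSize_le_of_thresholds`: `Af ≤ 1/240`; window
radius `r := 4Λₙ′₊₁ + 3Af + 1/2000` from `μ ∈ [−1.05, −0.15]`, `4Λₙ′₊₁ ≤ 1/32`; lattice margin `(4+2Af)·2π/L < 1/2000` from `L ≥ klEngL₃ ≥ 1024β² ≥ 2²⁴`; Matsubara box from
`β·4Λₙ′₊₁/(2π) + 1 ≤ M`).  `hexLadMV ⇒ hexLadMD` is NOT claimed (the data form is a different currency); `hexLadMD` is what E1's (Σλ1)/(Σλ2) rows feed directly.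
Plumbing only; every row of `hexLadMD` is a producer HYPOTHESIS (class #1 / (c) closer / k3c2-p2 (F)(i) / E1 / #18); nothing here asserts (c), any open row of 20437, K3, U₀,
the window or superconductivity.  0 kit · 0 lit.  [cite: BenfattoGiulianiMastropietro2006, §2.9]
-/


noncomputable section

namespace Summit.HubbardSuperconductivity.HubbardSuperconductivity.Theorems.EngineV8

set_option linter.dupNamespace false -- summit = problem name (single-conjunct summit), D-0017

open Real Set Finset Complex Matrix Literature.MathematicalPhysics.QuantumLattice GrassmannAlgebra
open Literature.Probability.LatticeModels hiding torusSupNorm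
open Literature.MathematicalPhysics.QuantumLattice.FermiRG
open Summit.HubbardSuperconductivity.HubbardSuperconductivity.Theorems.KLProgrammeLegKernels
open Summit.HubbardSuperconductivity.HubbardSuperconductivity.Theorems.TwoPointAssembly
open Summit.HubbardSuperconductivity.HubbardSuperconductivity.Theorems.DispersionFlow
open Summit.HubbardSuperconductivity.HubbardSuperconductivity.Theorems.KLRegimeWick
open Summit.HubbardSuperconductivity.HubbardSuperconductivity.Theorems.KLRegimeSplit
open Literature.MathematicalPhysics.QuantumLattice.BandSectorCounting
open Summit.HubbardSuperconductivity.HubbardSuperconductivity.Theorems.PerturbedFermiCurve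

section LadTowerMD

set_option maxHeartbeats 3200000 in -- two very long binder lists (row (c)'s prefix + the profile-form rows / the verbatim `hexLadPkg` type); plumbing only
/-- **Binder #8 `hexLadPkg` from hsucc-shaped rows with `RH RP RQ RL` as localised value rows and the Σ-class in (C′) DATA form** (see the module docstring): the conclusion is
`hexLadPkg`'s type VERBATIM. [cite: BenfattoGiulianiMastropietro2006, §2.9] -/
theorem rowC_hexLadPkg_of_towerSigmaData
    (hexLadMD : ∀ (P : SplitConsts) (R : RenConsts) (c : ℝ), P.WF → R.WF2 → 0 < c → c ≤ klEngC₃7GU klEngGeo14 P R →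
          ∀ μ ∈ klWindowC, ∀ U : ℝ, 0 < U → U ≤ klEngU₀12GQ klEngGeo14 (klEngQ9dG klEngGeo14 P R) P R c → ∀ β : ℝ, klBetaMin ≤ β → β ≤ Real.exp (c / U ^ 2) →
            ∀ (L M : ℕ) [NeZero L] [NeZero M], klEngL₄ P R β U ≤ L → klEngM₃ β U L ≤ M →
              ∀ n : ℕ, 1 ≤ n → n ≤ nScales β + 1 → IsKLRegime U c (-(n : ℤ)) →
                HistP klPredsV17F2 L M klEngGeo14 P (klEngQ9dG klEngGeo14 P R) R β U μ 0 n →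
                  FrameOK R U (nScales β) μ (klFlowFrameU L M β U μ n) →
                    KernelNormsV4 L M P (klEngQ9dG klEngGeo14 P R) β U μ (klFlowFrameU L M β U μ n) n →
                      (∀ j ≤ n, (KernelNormsLevels L M P (klEngQ9dG klEngGeo14 P R) β U μ (klFlowFrameU L M β U μ n) j ∧
                        KernelNormsWt4 L M (klWtBudget P (klEngQ9dG klEngGeo14 P R) U j) β U μ (klFlowFrameU L M β U μ n) j)) →
                        (∀ j ≤ n, LevelsUExportMixedAt L M (klCU2 P R (klEngQ7 P R)) P β U μ j) →
                          (∀ j ≤ n, IsoTupleLineBAt L M klE5AM klE5cM (klE5dM P R) P β U μ j) →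
                            (∀ j ≤ n, PairTransferRelFamilyK5 L M klEngGeoTh P (klCT8 P R (klEngQ7 P R) klEngGeo14 klEngGeoTh) β U μ j) →
            ∀ n' : ℕ, n = n' + 1 →
            ∃ m : ℝ, 0 ≤ m ∧ (∀ Qm s t, ‖klPairArrayF L M β U μ n' Qm s t‖ ≤ m) ∧ m * (klEngGeo14.bhi / 4) ≤ 1 / 3 ∧
              (∀ Λ ∈ Icc (klScale klE0 (n' + 1)) (klScale klE0 n'), hubbardEffPartitionFnCT L M β U μ 0 (klFlowFrameU L M β U μ (n' + 1)) Λ ≠ 0) ∧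
              ∀ (A A' : ℕ → TorusSite 2 L → ℝ → Matrix (TorusSite 2 L) (TorusSite 2 L) ℂ) (b b' : ℕ → TorusSite 2 L → ℝ → TorusSite 2 L → ℂ) (ρ : ℕ → TorusSite 2 L → TorusSite 2 L → ℝ) (V : ℕ → ℝ → (Fin 4 → HubbardFieldIdx L M) → ℂ) (V6 : ℕ → ℝ → (Fin 6 → HubbardFieldIdx L M) → ℂ) (Sg : ℕ → ℝ → FreqMomentum L M → Fin 2 → ℂ) (Hd : ℕ → ℝ → (Fin 4 → HubbardFieldIdx L M) → ℂ) (Φ : ℕ → ℝ → FreqMomentum L M → ℝ) (Wd : ℝ → FreqMomentum L M → ℝ) (Br : ℕ → TorusSite 2 L → ℝ → TorusSite 2 L × MatsubaraIdx M → ℂ),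
      (A = fun j Qm t => Matrix.of fun k k' : TorusSite 2 L => if k ∈ klBall L μ 0 ∧ k' ∈ klBall L μ 0 then vertexFn L M β (gaussConv ℂ (softCovOf L M β μ (klFlowFrameU L M β U μ (n' + 1)) (softSymbolCompl L M β μ (klFlowFrameU L M β U μ (n' + 1)) (n' + 1) j) + hubbardCovAboveCT L M β μ 0 (klFlowFrameU L M β U μ (n' + 1)) (klScale klE0 (n' + 1)) - hubbardCovAboveCT L M β μ 0 (klFlowFrameU L M β U μ (n' + 1)) (klScale klE0 n' + t * (klScale klE0 (n' + 1) - klScale klE0 n'))) (hubbardEffectiveActionCT L M β U μ 0 (klFlowFrameU L M β U μ (n' + 1)) (klScale klE0 n' + t * (klScale klE0 (n' + 1) - klScale klE0 n')))) 4 ![(((omega0 M, k'), 0), 0), ((((omega0 M).rev, Qm - k'), 1), 0), ((((omega0 M).rev, Qm - k), 1), 1), (((omega0 M, k), 0), 1)] else 0) →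
      (A' = fun j Qm t => Matrix.of fun k k' : TorusSite 2 L => if k ∈ klBall L μ 0 ∧ k' ∈ klBall L μ 0 then (klScale klE0 (n' + 1) - klScale klE0 n') • -((2 : ℂ)⁻¹ * vertexFn L M β (gaussConv ℂ (softCovOf L M β μ (klFlowFrameU L M β U μ (n' + 1)) (softSymbolCompl L M β μ (klFlowFrameU L M β U μ (n' + 1)) (n' + 1) j) + hubbardCovAboveCT L M β μ 0 (klFlowFrameU L M β U μ (n' + 1)) (klScale klE0 (n' + 1)) - hubbardCovAboveCT L M β μ 0 (klFlowFrameU L M β U μ (n' + 1)) (klScale klE0 n' + t * (klScale klE0 (n' + 1) - klScale klE0 n'))) (grassmannDerivPairing ℂ (Matrix.of fun X Y : HubbardFieldIdx L M => deriv (fun Λ'' : ℝ => hubbardCovAboveCT L M β μ 0 (klFlowFrameU L M β U μ (n' + 1)) Λ'' X Y) (klScale klE0 n' + t * (klScale klE0 (n' + 1) - klScale klE0 n'))) (hubbardEffectiveActionCT L M β U μ 0 (klFlowFrameU L M β U μ (n' + 1)) (klScale klE0 n' + t * (klScale klE0 (n' + 1) - klScale klE0 n'))) (hubbardEffectiveActionCT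 L M β U μ 0 (klFlowFrameU L M β U μ (n' + 1)) (klScale klE0 n' + t * (klScale klE0 (n' + 1) - klScale klE0 n'))))) 4 ![(((omega0 M, k'), 0), 0), ((((omega0 M).rev, Qm - k'), 1), 0), ((((omega0 M).rev, Qm - k), 1), 1), (((omega0 M, k), 0), 1)]) else 0) →
      (b = fun j Qm t p => -((klBubbleMass L M β μ (klFlowFrameU L M β U μ (n' + 1)) (fun k => (softSymbolCompl L M β μ (klFlowFrameU L M β U μ (n' + 1)) (n' + 1) j) k + (hubbardCutoffWeightCT L M β μ (klFlowFrameU L M β U μ (n' + 1)) (klScale klE0 (n' + 1)) k - hubbardCutoffWeightCT L M β μ (klFlowFrameU L M β U μ (n' + 1)) (klScale klE0 n' + t * (klScale klE0 (n' + 1) - klScale klE0 n')) k)) (fun k => (softSymbolCompl L M β μ (klFlowFrameU L M β U μ (n' + 1)) (n' + 1) j) k + (hubbardCutoffWeightCT L M β μ (klFlowFrameU L M β U μ (n' + 1)) (klScale klE0 (n' + 1)) k - hubbardCutoffWeightCT L M β μ (klFlowFrameU L M β U μ (n' + 1)) (klScale klE0 n' + t * (klScale klE0 (n' + 1) - klScale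 klE0 n')) k)) Qm p : ℝ) : ℂ)) →
      (b' = fun j Qm t p => (((klScale klE0 (n' + 1) - klScale klE0 n') * (klBubbleMass L M β μ (klFlowFrameU L M β U μ (n' + 1)) (fun k => deriv (fun Λ' => hubbardCutoffWeightCT L M β μ (klFlowFrameU L M β U μ (n' + 1)) Λ' k) (klScale klE0 n' + t * (klScale klE0 (n' + 1) - klScale klE0 n'))) (fun k => (softSymbolCompl L M β μ (klFlowFrameU L M β U μ (n' + 1)) (n' + 1) j) k + (hubbardCutoffWeightCT L M β μ (klFlowFrameU L M β U μ (n' + 1)) (klScale klE0 (n' + 1)) k - hubbardCutoffWeightCT L M β μ (klFlowFrameU L M β U μ (n' + 1)) (klScale klE0 n' + t * (klScale klE0 (n' + 1) - klScale klE0 n')) k)) Qm p + klBubbleMass L M β μ (klFlowFrameU L M β U μ (n' + 1)) (fun k => (softSymbolCompl L M β μ (klFlowFrameU L M β U μ (n' + 1)) (n' + 1) j) k + (hubbardCutoffWeightCT L M β μ (klFlowFrameU L M β U μ (n' + 1)) (klScale klE0 (n' + 1)) k - hubbardCutoffWeightCT L M β μ (klFlowFrameU L M β U μ (n' + 1)) (klScale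 klE0 n' + t * (klScale klE0 (n' + 1) - klScale klE0 n')) k)) (fun k => deriv (fun Λ' => hubbardCutoffWeightCT L M β μ (klFlowFrameU L M β U μ (n' + 1)) Λ' k) (klScale klE0 n' + t * (klScale klE0 (n' + 1) - klScale klE0 n'))) Qm p) : ℝ) : ℂ)) →
      (ρ = fun j Qm c => klRungProfile L M β μ (klFlowFrameU L M β U μ (n' + 1)) n' (softSymbolCompl L M β μ (klFlowFrameU L M β U μ (n' + 1)) (n' + 1) j) Qm c) →
      (V = fun j t X => vertexFn L M β (gaussConv ℂ (softCovOf L M β μ (klFlowFrameU L M β U μ (n' + 1)) (softSymbolCompl L M β μ (klFlowFrameU L M β U μ (n' + 1)) (n' + 1) j) + hubbardCovAboveCT L M β μ 0 (klFlowFrameU L M β U μ (n' + 1)) (klScale klE0 (n' + 1)) - hubbardCovAboveCT L M β μ 0 (klFlowFrameU L M β U μ (n' + 1)) (klScale klE0 n' + t * (klScale klE0 (n' + 1) - klScale klE0 n'))) (hubbardEffectiveActionCT L M β U μ 0 (klFlowFrameU L M β U μ (n' + 1)) (klScale klE0 n' + t * (klScale klE0 (n' + 1) - klScale klE0 n'))))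 4 X) →
      (V6 = fun j t X => vertexFn L M β (gaussConv ℂ (softCovOf L M β μ (klFlowFrameU L M β U μ (n' + 1)) (softSymbolCompl L M β μ (klFlowFrameU L M β U μ (n' + 1)) (n' + 1) j) + hubbardCovAboveCT L M β μ 0 (klFlowFrameU L M β U μ (n' + 1)) (klScale klE0 (n' + 1)) - hubbardCovAboveCT L M β μ 0 (klFlowFrameU L M β U μ (n' + 1)) (klScale klE0 n' + t * (klScale klE0 (n' + 1) - klScale klE0 n'))) (hubbardEffectiveActionCT L M β U μ 0 (klFlowFrameU L M β U μ (n' + 1)) (klScale klE0 n' + t * (klScale klE0 (n' + 1) - klScale klE0 n')))) 6 X) →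
      (Sg = fun j t p σ => selfEnergy L M β (gaussConv ℂ (softCovOf L M β μ (klFlowFrameU L M β U μ (n' + 1)) (softSymbolCompl L M β μ (klFlowFrameU L M β U μ (n' + 1)) (n' + 1) j) + hubbardCovAboveCT L M β μ 0 (klFlowFrameU L M β U μ (n' + 1)) (klScale klE0 (n' + 1)) - hubbardCovAboveCT L M β μ 0 (klFlowFrameU L M β U μ (n' + 1)) (klScale klE0 n' + t * (klScale klE0 (n' + 1) - klScale klE0 n'))) (hubbardEffectiveActionCT L M β U μ 0 (klFlowFrameU L M β U μ (n' + 1)) (klScale klE0 n' + t * (klScale klE0 (n' + 1) - klScale klE0 n')))) p σ) →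
      (Hd = fun j t X => vertexFn L M β (dblFold ℂ (grassmannLaplacian ℂ (crossCov ℂ (Matrix.of fun X Y : HubbardFieldIdx L M => deriv (fun Λ' : ℝ => hubbardCovAboveCT L M β μ 0 (klFlowFrameU L M β U μ (n' + 1)) Λ' X Y) (klScale klE0 n' + t * (klScale klE0 (n' + 1) - klScale klE0 n')))) ((gaussConv ℂ (crossCov ℂ (softCovOf L M β μ (klFlowFrameU L M β U μ (n' + 1)) (softSymbolCompl L M β μ (klFlowFrameU L M β U μ (n' + 1)) (n' + 1) j) + hubbardCovAboveCT L M β μ 0 (klFlowFrameU L M β U μ (n' + 1)) (klScale klE0 (n' + 1)) - hubbardCovAboveCT L M β μ 0 (klFlowFrameU L M β U μ (n' + 1)) (klScale klE0 n' + t * (klScale klE0 (n' + 1) - klScale klE0 n')))) - grassmannLaplacian ℂ (crossCov ℂ (softCovOf L M β μ (klFlowFrameU L M β U μ (n' + 1)) (softSymbolCompl L M β μ (klFlowFrameU L M β U μ (n' + 1)) (n' + 1) j) + hubbardCovAboveCT L M β μ 0 (klFlowFrameU L M β U μ (n' + 1)) (klScale klE0 (n' + 1)) - hubbardCovAboveCT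 L M β μ 0 (klFlowFrameU L M β U μ (n' + 1)) (klScale klE0 n' + t * (klScale klE0 (n' + 1) - klScale klE0 n'))))) (dblCopy ℂ 0 (gaussConv ℂ (softCovOf L M β μ (klFlowFrameU L M β U μ (n' + 1)) (softSymbolCompl L M β μ (klFlowFrameU L M β U μ (n' + 1)) (n' + 1) j) + hubbardCovAboveCT L M β μ 0 (klFlowFrameU L M β U μ (n' + 1)) (klScale klE0 (n' + 1)) - hubbardCovAboveCT L M β μ 0 (klFlowFrameU L M β U μ (n' + 1)) (klScale klE0 n' + t * (klScale klE0 (n' + 1) - klScale klE0 n'))) (hubbardEffectiveActionCT L M β U μ 0 (klFlowFrameU L M β U μ (n' + 1)) (klScale klE0 n' + t * (klScale klE0 (n' + 1) - klScale klE0 n')))) * dblCopy ℂ 1 (gaussConv ℂ (softCovOf L M β μ (klFlowFrameU L M β U μ (n' + 1)) (softSymbolCompl L M β μ (klFlowFrameU L M β U μ (n' + 1)) (n' + 1) j) + hubbardCovAboveCT L M β μ 0 (klFlowFrameU L M β U μ (n' + 1)) (klScale klE0 (n' + 1)) - hubbardCovAboveCT L M β μ 0 (klFlowFrameU L M β U μ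 (n' + 1)) (klScale klE0 n' + t * (klScale klE0 (n' + 1) - klScale klE0 n'))) (hubbardEffectiveActionCT L M β U μ 0 (klFlowFrameU L M β U μ (n' + 1)) (klScale klE0 n' + t * (klScale klE0 (n' + 1) - klScale klE0 n')))))))) 4 X) →
      (Φ = fun j t k => (softSymbolCompl L M β μ (klFlowFrameU L M β U μ (n' + 1)) (n' + 1) j) k + (hubbardCutoffWeightCT L M β μ (klFlowFrameU L M β U μ (n' + 1)) (klScale klE0 (n' + 1)) k - hubbardCutoffWeightCT L M β μ (klFlowFrameU L M β U μ (n' + 1)) (klScale klE0 n' + t * (klScale klE0 (n' + 1) - klScale klE0 n')) k)) →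
      (Wd = fun t k => deriv (fun Λ' : ℝ => hubbardCutoffWeightCT L M β μ (klFlowFrameU L M β U μ (n' + 1)) Λ' k) (klScale klE0 n' + t * (klScale klE0 (n' + 1) - klScale klE0 n'))) →
      (Br = fun j Qm t z => -(((((β * (L : ℝ) ^ 2 : ℝ) : ℂ)))⁻¹ * propCT L M β μ (klFlowFrameU L M β U μ (n' + 1)) (z.2, z.1) * propCT L M β μ (klFlowFrameU L M β U μ (n' + 1)) (z.2.rev, Qm - z.1)) * ((((klScale klE0 (n' + 1) - klScale klE0 n') * (-Wd t (z.2, z.1) * Φ j t (z.2.rev, Qm - z.1) - Φ j t (z.2, z.1) * Wd t (z.2.rev, Qm - z.1))) : ℝ) : ℂ)) →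
      ∀ Qm : TorusSite 2 L, IsPairClassAt L Qm (n' + 1) →
      ∃ (r' e₁ : ℝ) (η E₁ RH RP RQ RS RL : TorusSite 2 L → TorusSite 2 L → ℝ), 0 ≤ r' ∧ 0 ≤ e₁ ∧
        -- a priori along the slice; history a priori [class #1]
        (∀ t ∈ Icc (0 : ℝ) 1, ∀ x y, ‖A (n' + 1) Qm t x y‖ ≤ m) ∧
        (∀ x y, ‖klMemberArrayF L M β U μ n' (softSymbolCompl L M β μ (klFlowFrameU L M β U μ n') n' (n' + 1)) Qm x y‖ ≤ m) ∧
        -- (F)(i): majorant of the FRAME SHIFT `K_n → K_(n'+1)` of the history member (model objects) + its scalar cap [k3c2-p2]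
        (∀ x y, ‖((Matrix.of fun k k' : TorusSite 2 L => if k ∈ klBall L μ 0 ∧ k' ∈ klBall L μ 0 then klCovSmearedPairAmplitude L M β U μ (klFlowFrameU L M β U μ (n' + 1)) n' (softCovOf L M β μ (klFlowFrameU L M β U μ (n' + 1)) (softSymbolCompl L M β μ (klFlowFrameU L M β U μ (n' + 1)) n' (n' + 1))) Qm k k' else 0) - klMemberArrayF L M β U μ n' (softSymbolCompl L M β μ (klFlowFrameU L M β U μ n') n' (n' + 1)) Qm) x y‖ ≤ η x y) ∧ (∀ x y, η x y ≤ r') ∧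
        -- smallness of the NAMED tower weight
        (3 / 2 * m + r') * ∑ p, |klSliceWeightSmeared L M β μ (klFlowFrameU L M β U μ (n' + 1)) (n' + 1) (fun _ => (0 : ℝ)) Qm p| ≤ 1 / 3 ∧
        -- the FIVE loop classes of the resolved source AS LOCALISED VALUE ROWS (`klmd_defect_le_rows_family`'s own hypotheses at `j = n'+1`, kernels INSIDE the loop sums,
        -- norm outside; NO kernel sup, NO weight mass): «≥ 2 cross lines» `RH`, particle–hole direct `RP`, particle–hole exchange `RQ`, the 6–2 / born Σ-triple `RS`, localisation `RL`
        (∀ t ∈ Icc (0 : ℝ) 1, ∀ x y : TorusSite 2 L, ‖Hd (n' + 1) t ![(((omega0 M, y), 0), 0), ((((omega0 M).rev, Qm - y), 1), 0), ((((omega0 M).rev, Qm - x), 1), 1), (((omega0 M, x), 0), 1)]‖ ≤ RH x y) ∧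
        (∀ t ∈ Icc (0 : ℝ) 1, ∀ x y : TorusSite 2 L, ‖(∑ p : FreqMomentum L M, ∑ σ : Fin 2, ∑ p' : FreqMomentum L M, if matsubaraInt M p'.1 + matsubaraInt M (omega0 M) = matsubaraInt M p.1 + matsubaraInt M (omega0 M) ∧ p'.2 = p.2 + x - y then ((((((Φ (n' + 1) t p) : ℝ) : ℂ) * (((β * (L : ℝ) ^ 2 : ℝ) : ℂ) * propCT L M β μ (klFlowFrameU L M β U μ (n' + 1)) p)) * ((((Wd t p') : ℝ) : ℂ) * (((β * (L : ℝ) ^ 2 : ℝ) : ℂ) * propCT L M β μ (klFlowFrameU L M β U μ (n' + 1)) p'))) + (((((Wd t p) : ℝ) : ℂ) * (((β * (L : ℝ) ^ 2 : ℝ) : ℂ) * propCT L M β μ (klFlowFrameU L M β U μ (n' + 1)) p)) * ((((Φ (n' + 1) t p') : ℝ) : ℂ) * (((β * (L : ℝ) ^ 2 : ℝ) : ℂ) * propCT L M β μ (klFlowFrameU L M β U μ (n' + 1)) p')))) * (V (n' + 1) t ![((p, σ), 1), ((p', σ), 0), (((omega0 M, y), 0), 0), (((omega0 M, x), 0), 1)]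 * V (n' + 1) t ![((p, σ), 0), ((p', σ), 1), ((((omega0 M).rev, Qm - y), 1), 0), ((((omega0 M).rev, Qm - x), 1), 1)]) else 0)‖ ≤ RP x y) ∧
        (∀ t ∈ Icc (0 : ℝ) 1, ∀ x y : TorusSite 2 L, ‖(∑ p : FreqMomentum L M, ∑ p' : FreqMomentum L M, if matsubaraInt M p'.1 + matsubaraInt M (omega0 M) + matsubaraInt M (omega0 M) + 1 = matsubaraInt M p.1 ∧ p'.2 = p.2 + Qm - x - y then ((((((Φ (n' + 1) t p) : ℝ) : ℂ) * (((β * (L : ℝ) ^ 2 : ℝ) : ℂ) * propCT L M β μ (klFlowFrameU L M β U μ (n' + 1)) p)) * ((((Wd t p') : ℝ) : ℂ) * (((β * (L : ℝ) ^ 2 : ℝ) : ℂ) * propCT L M β μ (klFlowFrameU L M β U μ (n' + 1)) p'))) + (((((Wd t p) : ℝ) : ℂ) * (((β * (L : ℝ) ^ 2 : ℝ) : ℂ) * propCT L M β μ (klFlowFrameU L M β U μ (n' + 1)) p)) * ((((Φ (n' + 1) t p') : ℝ) : ℂ) * (((β * (L : ℝ) ^ 2 : ℝ) : ℂ) * propCT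 L M β μ (klFlowFrameU L M β U μ (n' + 1)) p')))) * (V (n' + 1) t ![((p, 0), 1), ((p', 1), 0), (((omega0 M, y), 0), 0), ((((omega0 M).rev, Qm - x), 1), 1)] * V (n' + 1) t ![((p, 0), 0), ((p', 1), 1), ((((omega0 M).rev, Qm - y), 1), 0), (((omega0 M, x), 0), 1)]) else 0)‖ ≤ RQ x y) ∧
        -- the 6–2 / born Σ-class IN (C′) DATA FORM [E1: (Σλ1)/(Σλ2)]: per `(t, x, y)` the self-energy line's LOCALISATION DATA `(T, Sg₀, zω, ze, δ)` on the hard shell and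
        -- ONE arithmetic domination row (O5c's closed-form majorant, profile constants discharged, `≤` the Σ-slot `(Λd)(βL²)⁻³·RS`); the VALUE row `‖Σ_pΣ_σ(Ẇĝ)(Φĝ)·V6·Sg‖ ≤ RS`
        -- is DERIVED by the producer (`klmt_htower_family_sigmaData` ∘ `klok_localisedBorn_row_full_le`); chart `B = bandBounds(−6/5,−1/10)`, frame size `Af(R,U,c)` WRITTEN OUT
        (∀ t ∈ Icc (0 : ℝ) 1, ∀ x y : TorusSite 2 L, ∃ (T : Fin 2 → ℂ) (Sg₀ zω ze : ℂ) (δ : ℝ), 0 ≤ δ ∧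
          (∀ p : FreqMomentum L M, ∀ σ : Fin 2, Wd t p ≠ 0 →
            ‖V6 (n' + 1) t ![((p, σ), 0), ((p, σ), 1), (((omega0 M, y), 0), 0), ((((omega0 M).rev, Qm - y), 1), 0), ((((omega0 M).rev, Qm - x), 1), 1), (((omega0 M, x), 0), 1)] * Sg (n' + 1) t p σ -
                T σ * (Sg₀ + zω * (Complex.I * (matsubaraFreq β M p.1 : ℂ)) + ze * (nambuXiCT L μ (klFlowFrameU L M β U μ (n' + 1)) p.2 : ℂ))‖ ≤ δ) ∧
          (klScale klE0 n' - klScale klE0 (n' + 1)) / (β * (L : ℝ) ^ 2) * ‖∑ σ : Fin 2, T σ‖ *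
            ((‖2 * zω + ze‖ * (((klScale klE0 n' + t * (klScale klE0 (n' + 1) - klScale klE0 n')) * β / π + 1) * ((8 / klScale klE0 (n' + 1)) / ((klScale klE0 n' + t * (klScale klE0 (n' + 1) - klScale klE0 n')) / 2) ^ 2) +
                2 * (klScale klE0 n' + t * (klScale klE0 (n' + 1) - klScale klE0 n')) *
                  (((klScale klE0 n' + t * (klScale klE0 (n' + 1) - klScale klE0 n')) * β / π + 1) * (((2 * (448 / 3 * Real.exp 2) + 72) / klScale klE0 (n' + 1) ^ 3) / ((klScale klE0 n' + t * (klScale klE0 (n' + 1) - klScale klE0 n')) / 2) ^ 2 + (8 / klScale klE0 (n' + 1)) / ((klScale klE0 n' + t * (klScale klE0 (n' + 1) - klScale klE0 n')) / 2) ^ 4)) *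
                  (2 * (2 * (klScale klE0 n' + t * (klScale klE0 (n' + 1) - klScale klE0 n'))))) +
              2 * ‖zω + ze‖ * (3 * (2 * (klScale klE0 n' + t * (klScale klE0 (n' + 1) - klScale klE0 n'))) ^ 2 *
                  (((klScale klE0 n' + t * (klScale klE0 (n' + 1) - klScale klE0 n')) * β / π + 1) * ((8 / klScale klE0 (n' + 1)) / ((klScale klE0 n' + t * (klScale klE0 (n' + 1) - klScale klE0 n')) / 2) ^ 4)) +
                (2 * (klScale klE0 n' + t * (klScale klE0 (n' + 1) - klScale klE0 n'))) ^ 3 *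
                  (((klScale klE0 n' + t * (klScale klE0 (n' + 1) - klScale klE0 n')) * β / π + 1) * (((2 * (448 / 3 * Real.exp 2) + 72) / klScale klE0 (n' + 1) ^ 3) / ((klScale klE0 n' + t * (klScale klE0 (n' + 1) - klScale klE0 n')) / 2) ^ 4 + 2 * (8 / klScale klE0 (n' + 1)) / ((klScale klE0 n' + t * (klScale klE0 (n' + 1) - klScale klE0 n')) / 2) ^ 6)) *
                  (2 * (2 * (klScale klE0 n' + t * (klScale klE0 (n' + 1) - klScale klE0 n')))))) *
            ((klScale klE0 n' + t * (klScale klE0 (n' + 1) - klScale klE0 n')) * (((L : ℝ) / (2 * π)) ^ 2 *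
              (4 * π * (1 / ((bandBounds (show (-4 : ℝ) < -(6 / 5) by norm_num) (show (-(6 / 5) : ℝ) ≤ -(1 / 10) by norm_num) (show (-(1 / 10) : ℝ) < 0 by norm_num)).Dtmin - 2 * (2 * R.Gfr 0 * |U| + 2 * R.Gfr 1 * U ^ 2 + R.Gfr 2 * (c / Real.log 4))) ^ 2 + Real.pi * Real.sqrt 2 * (2 + 4 * (2 * R.Gfr 0 * |U| + 2 * R.Gfr 1 * U ^ 2 + R.Gfr 2 * (c / Real.log 4))) / ((bandBounds (show (-4 : ℝ) < -(6 / 5) by norm_num) (show (-(6 / 5) : ℝ) ≤ -(1 / 10) by norm_num) (show (-(1 / 10) : ℝ) < 0 by norm_num)).Dtmin - 2 * (2 * R.Gfr 0 * |U| + 2 * R.Gfr 1 * U ^ 2 + R.Gfr 2 * (c / Real.log 4))) ^ 3) *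
                  (klScale klE0 n' + t * (klScale klE0 (n' + 1) - klScale klE0 n')) ^ 2 +
                4 * (2 * π * (π * Real.sqrt 2 / ((bandBounds (show (-4 : ℝ) < -(6 / 5) by norm_num) (show (-(6 / 5) : ℝ) ≤ -(1 / 10) by norm_num) (show (-(1 / 10) : ℝ) < 0 by norm_num)).Dtmin - 2 * (2 * R.Gfr 0 * |U| + 2 * R.Gfr 1 * U ^ 2 + R.Gfr 2 * (c / Real.log 4))))) * ((4 + 2 * (2 * R.Gfr 0 * |U| + 2 * R.Gfr 1 * U ^ 2 + R.Gfr 2 * (c / Real.log 4))) * (2 * π / L)))))) +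
          ((klScale klE0 n' - klScale klE0 (n' + 1)) * ‖∑ σ : Fin 2, T σ * Sg₀‖ *
            (((2 * π) ^ 2)⁻¹ * (2 * π * (π * Real.sqrt 2 / ((bandBounds (show (-4 : ℝ) < -(6 / 5) by norm_num) (show (-(6 / 5) : ℝ) ≤ -(1 / 10) by norm_num) (show (-(1 / 10) : ℝ) < 0 by norm_num)).Dtmin - 2 * (2 * R.Gfr 0 * |U| + 2 * R.Gfr 1 * U ^ 2 + R.Gfr 2 * (c / Real.log 4)))) *
                  ((2 * (klScale klE0 n' + t * (klScale klE0 (n' + 1) - klScale klE0 n')) * (2 * (klScale klE0 n' + t * (klScale klE0 (n' + 1) - klScale klE0 n')) *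
                    (2 * (klScale klE0 n' + t * (klScale klE0 (n' + 1) - klScale klE0 n')) ^ 2 * (((2 * (448 / 3 * Real.exp 2) + 72) / klScale klE0 (n' + 1) ^ 3) / ((klScale klE0 n' + t * (klScale klE0 (n' + 1) - klScale klE0 n')) / 2) ^ 4 + 2 * (8 / klScale klE0 (n' + 1)) / ((klScale klE0 n' + t * (klScale klE0 (n' + 1) - klScale klE0 n')) / 2) ^ 6) + (((2 * (448 / 3 * Real.exp 2) + 72) / klScale klE0 (n' + 1) ^ 3) / ((klScale klE0 n' + t * (klScale klE0 (n' + 1) - klScale klE0 n')) / 2) ^ 2 + (8 / klScale klE0 (n' + 1)) / ((klScale klE0 n' + t * (klScale klE0 (n' + 1) - klScale klE0 n')) / 2) ^ 4)))) *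
                    ((klScale klE0 n' + t * (klScale klE0 (n' + 1) - klScale klE0 n')) + 2 * Real.pi / β) / β) +
                β⁻¹ * (((klScale klE0 n' + t * (klScale klE0 (n' + 1) - klScale klE0 n')) * β / π + 1) *
                  (2 * (klScale klE0 n' + t * (klScale klE0 (n' + 1) - klScale klE0 n')) *
                    (2 * π * (1 / ((bandBounds (show (-4 : ℝ) < -(6 / 5) by norm_num) (show (-(6 / 5) : ℝ) ≤ -(1 / 10) by norm_num) (show (-(1 / 10) : ℝ) < 0 by norm_num)).Dtmin - 2 * (2 * R.Gfr 0 * |U| + 2 * R.Gfr 1 * U ^ 2 + R.Gfr 2 * (c / Real.log 4))) ^ 2 + Real.pi * Real.sqrt 2 * (2 + 4 * (2 * R.Gfr 0 * |U| + 2 * R.Gfr 1 * U ^ 2 + R.Gfr 2 * (c / Real.log 4))) / ((bandBounds (show (-4 : ℝ) < -(6 / 5) by norm_num) (show (-(6 / 5) : ℝ) ≤ -(1 / 10) by norm_num) (show (-(1 / 10) : ℝ) < 0 by norm_num)).Dtmin - 2 * (2 * R.Gfr 0 * |U| + 2 * R.Gfr 1 * U ^ 2 + R.Gfr 2 * (c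 / Real.log 4))) ^ 3) *
                      (klScale klE0 n' + t * (klScale klE0 (n' + 1) - klScale klE0 n')) * ((8 / klScale klE0 (n' + 1)) / ((klScale klE0 n' + t * (klScale klE0 (n' + 1) - klScale klE0 n')) / 2) ^ 2))))) +
              ((klScale klE0 n' + t * (klScale klE0 (n' + 1) - klScale klE0 n')) / π + 3 / β) *
                (2 * π * (2 * (klScale klE0 n' + t * (klScale klE0 (n' + 1) - klScale klE0 n')) *
                  (2 * (klScale klE0 n' + t * (klScale klE0 (n' + 1) - klScale klE0 n')) ^ 2 * (((2 * (448 / 3 * Real.exp 2) + 72) / klScale klE0 (n' + 1) ^ 3) / ((klScale klE0 n' + t * (klScale klE0 (n' + 1) - klScale klE0 n')) / 2) ^ 4 + 2 * (8 / klScale klE0 (n' + 1)) / ((klScale klE0 n' + t * (klScale klE0 (n' + 1) - klScale klE0 n')) / 2) ^ 6) + (((2 * (448 / 3 * Real.exp 2) + 72) / klScale klE0 (n' + 1) ^ 3) / ((klScale klE0 n' + t * (klScale klE0 (n' + 1) - klScale klE0 n')) / 2) ^ 2 + (8 / klScale klE0 (n' + 1)) / ((klScale klE0 n' + t * (klScale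 klE0 (n' + 1) - klScale klE0 n')) / 2) ^ 4)) *
                  (4 + 2 * (2 * R.Gfr 0 * |U| + 2 * R.Gfr 1 * U ^ 2 + R.Gfr 2 * (c / Real.log 4)))) / L)) +
            (2 : ℝ) ^ 10 * 15367 * δ) ≤
            (klScale klE0 n' - klScale klE0 (n' + 1)) * ((β * (L : ℝ) ^ 2) ^ 3)⁻¹ * RS x y) ∧
        (∀ t ∈ Icc (0 : ℝ) 1, ∀ x y : TorusSite 2 L, ‖∑ z : TorusSite 2 L × MatsubaraIdx M, Br (n' + 1) Qm t z * ((if z.1 ∈ klBall L μ 0 then V (n' + 1) t ![(((omega0 M, z.1), 0), 0), ((((omega0 M).rev, Qm - z.1), 1), 0), ((((omega0 M).rev, Qm - x), 1), 1), (((omega0 M, x), 0), 1)] * V (n' + 1) t ![(((omega0 M, y), 0), 0), ((((omega0 M).rev, Qm - y), 1), 0), ((((omega0 M).rev, Qm - z.1), 1), 1), (((omega0 M, z.1), 0), 1)] else 0) - V (n' + 1) t ![(((z.2, z.1), 0), 0), (((z.2.rev, Qm - z.1), 1), 0), ((((omega0 M).rev, Qm - x), 1), 1), (((omega0 M, x),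 0), 1)] * V (n' + 1) t ![(((omega0 M, y), 0), 0), ((((omega0 M).rev, Qm - y), 1), 0), (((z.2.rev, Qm - z.1), 1), 1), (((z.2, z.1), 0), 1)])‖ ≤ RL x y) ∧
        -- consumer-side rows at the bar `transferBarRelIdx L klEngGeoTh P (klCT8 P R (klEngQ7 P R) klEngGeo14 klEngGeoTh) β U n' n' Qm` and the slot `Bar Qm`; the source majorant `FT_ρ[J] + FT_w[η]` WRITTEN OUT with `J = (Λd)(½RH + (βL²)⁻³(RP + RQ + 2RS)) + RL`
        (∀ x y, transferBarRelIdx L klEngGeoTh P (klCT8 P R (klEngQ7 P R) klEngGeo14 klEngGeoTh) β U n' n' Qm x y ≤ r') ∧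
        (∀ x y, ((((klScale klE0 n' - klScale klE0 (n' + 1)) * (2⁻¹ * RH x y + ((β * (L : ℝ) ^ 2) ^ 3)⁻¹ * (RP x y + RQ x y + 2 * RS x y)) + RL x y) + 3 / 2 * (3 / 2 * m) * ∑ c, ((klScale klE0 n' - klScale klE0 (n' + 1)) * (2⁻¹ * RH x c + ((β * (L : ℝ) ^ 2) ^ 3)⁻¹ * (RP x c + RQ x c + 2 * RS x c)) + RL x c) * ρ (n' + 1) Qm c + 3 / 2 * m * ∑ a, ρ (n' + 1) Qm a * ((klScale klE0 n' - klScale klE0 (n' + 1)) * (2⁻¹ * RH a y + ((β * (L : ℝ) ^ 2) ^ 3)⁻¹ * (RP a y + RQ a y + 2 * RS a y)) + RL a y) + 9 / 4 * m * (3 / 2 * m) * ∑ a, ∑ c, ρ (n' + 1) Qm a * ((klScale klE0 n' - klScale klE0 (n' + 1)) * (2⁻¹ * RH a c + ((β * (L : ℝ) ^ 2) ^ 3)⁻¹ * (RP a c + RQ a c + 2 * RS a c)) + RL a c) * ρ (n' + 1) Qm c) +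
            (η x y + 3 / 2 * (3 / 2 * m) * ∑ t, η x t * |klSliceWeightSmeared L M β μ (klFlowFrameU L M β U μ (n' + 1)) (n' + 1) (fun _ => (0 : ℝ)) Qm t| + 3 / 2 * (3 / 2 * m + r') * ∑ a, |klSliceWeightSmeared L M β μ (klFlowFrameU L M β U μ (n' + 1)) (n' + 1) (fun _ => (0 : ℝ)) Qm a| * η a y + 9 / 4 * (3 / 2 * m + r') * (3 / 2 * m) * ∑ a, ∑ t, |klSliceWeightSmeared L M β μ (klFlowFrameU L M β U μ (n' + 1)) (n' + 1) (fun _ => (0 : ℝ)) Qm a| * η a t * |klSliceWeightSmeared L M β μ (klFlowFrameU L M β U μ (n' + 1)) (n' + 1) (fun _ => (0 : ℝ)) Qm t|)) +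
          (transferBarRelIdx L klEngGeoTh P (klCT8 P R (klEngQ7 P R) klEngGeo14 klEngGeoTh) β U n' n' Qm x y + 3 / 2 * (3 / 2 * m) * ∑ t, transferBarRelIdx L klEngGeoTh P (klCT8 P R (klEngQ7 P R) klEngGeo14 klEngGeoTh) β U n' n' Qm x t * |klSliceWeightSmeared L M β μ (klFlowFrameU L M β U μ (n' + 1)) (n' + 1) (fun _ => (0 : ℝ)) Qm t| + 3 / 2 * (3 / 2 * m + r') * ∑ a, |klSliceWeightSmeared L M β μ (klFlowFrameU L M β U μ (n' + 1)) (n' + 1) (fun _ => (0 : ℝ)) Qm a| * transferBarRelIdx L klEngGeoTh P (klCT8 P R (klEngQ7 P R) klEngGeo14 klEngGeoTh) β U n' n' Qm a y + 9 / 4 * (3 / 2 * m + r') * (3 / 2 * m) * ∑ a, ∑ t, |klSliceWeightSmeared L M β μ (klFlowFrameU L M β U μ (n' + 1)) (n' + 1) (fun _ => (0 : ℝ)) Qm a| * transferBarRelIdx L klEngGeoTh P (klCT8 P R (klEngQ7 P R) klEngGeo14 klEngGeoTh) β U n' n' Qm a t * |klSliceWeightSmeared L M β μ (klFlowFrameU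 L M β U μ (n' + 1)) (n' + 1) (fun _ => (0 : ℝ)) Qm t|) ≤ E₁ x y) ∧
        (∀ x y, E₁ x y ≤ e₁) ∧
        (∀ k ∈ klBall L μ 0, ∀ k' ∈ klBall L μ 0, E₁ k k' ≤ drivePBar klEngGeo14 P U n' + eremBar klEngGeo14 P (klEngQ9dG klEngGeo14 P R) U β L n' + thermalBar klEngGeo14 P U β (n' + 1) +
              legDressBarQ2 klEngGeo14 P (klEngQ9dG klEngGeo14 P R) U (n' + 1) (legSliceCountT L β μ (klFlowFrameU L M β U μ (n' + 1)) (n' + 1) ![k', Qm - k', Qm - k, k]) +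
              (P.Klam * U) ^ 2 * (klEngGeo14.phGain (n' + 1) (klTorusNorm L (k - k')) + klEngGeo14.phGain (n' + 1) (klTorusNorm L (k + k' - Qm))) +
              frameShiftBar P (klEngQ9dG klEngGeo14 P R) U (n' + 1))) :
    ∀ (P : SplitConsts) (R : RenConsts) (c : ℝ), P.WF → R.WF2 → 0 < c → c ≤ klEngC₃7GU klEngGeo14 P R →
          ∀ μ ∈ klWindowC, ∀ U : ℝ, 0 < U → U ≤ klEngU₀12GQ klEngGeo14 (klEngQ9dG klEngGeo14 P R) P R c → ∀ β : ℝ, klBetaMin ≤ β → β ≤ Real.exp (c / U ^ 2) →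
            ∀ (L M : ℕ) [NeZero L] [NeZero M], klEngL₄ P R β U ≤ L → klEngM₃ β U L ≤ M →
              ∀ n : ℕ, 1 ≤ n → n ≤ nScales β + 1 → IsKLRegime U c (-(n : ℤ)) →
                HistP klPredsV17F2 L M klEngGeo14 P (klEngQ9dG klEngGeo14 P R) R β U μ 0 n →
                  FrameOK R U (nScales β) μ (klFlowFrameU L M β U μ n) →
                    KernelNormsV4 L M P (klEngQ9dG klEngGeo14 P R) β U μ (klFlowFrameU L M β U μ n) n →
                      (∀ j ≤ n, (KernelNormsLevels L M P (klEngQ9dG klEngGeo14 P R) β U μ (klFlowFrameU L M β U μ n) j ∧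
                        KernelNormsWt4 L M (klWtBudget P (klEngQ9dG klEngGeo14 P R) U j) β U μ (klFlowFrameU L M β U μ n) j)) →
                        (∀ j ≤ n, LevelsUExportMixedAt L M (klCU2 P R (klEngQ7 P R)) P β U μ j) →
                          (∀ j ≤ n, IsoTupleLineBAt L M klE5AM klE5cM (klE5dM P R) P β U μ j) →
                            (∀ j ≤ n, PairTransferRelFamilyK5 L M klEngGeoTh P (klCT8 P R (klEngQ7 P R) klEngGeo14 klEngGeoTh) β U μ j) →
            ∃ m : ℝ, 0 ≤ m ∧ (∀ Qm s t, ‖klPairArrayF L M β U μ (n - 1) Qm s t‖ ≤ m) ∧ m * (klEngGeo14.bhi / 4) ≤ 1 / 3 ∧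
              (∀ Qm : TorusSite 2 L, IsPairClassAt L Qm n → ∃ (X Nm : Matrix (TorusSite 2 L) (TorusSite 2 L) ℂ) (w₁ : TorusSite 2 L → ℝ) (Ea E₁ : TorusSite 2 L → TorusSite 2 L → ℝ) (r' e₁ : ℝ), 0 ≤ r' ∧ 0 ≤ e₁ ∧ (∀ x y, ¬(x ∈ klBall L μ 0 ∧ y ∈ klBall L μ 0) → X x y = 0) ∧ (∀ k ∈ klBall L μ 0, ∀ k' ∈ klBall L μ 0, X k
                  k' = klCovSmearedPairAmplitude L M β U μ (klFlowFrameU L M β U μ (n - 1)) (n - 1) (softCovOf L M β μ (klFlowFrameU L M β U μ (n - 1)) (softSymbolCompl L M β μ (klFlowFrameU L M β U μ (n - 1)) (n - 1) n)) Qm k k') ∧ (∀ x y, 0 ≤ Ea x y) ∧ (1 + Matrix.diagonal (fun p => (w₁ p : ℂ)) * X) * Nm = 1 ∧ (∀ k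
                  ∈ klBall L μ 0, ∀ k' ∈ klBall L μ 0, ‖klPairArrayF L M β U μ n Qm k k' - (X * Nm) k k'‖ ≤ Ea k k') ∧ (∀ x y, transferBarRelIdx L klEngGeoTh P (klCT8 P R (klEngQ7 P R) klEngGeo14 klEngGeoTh) β U (n - 1) (n - 1) Qm x y ≤ r') ∧ (∀ x y, Ea x y + (transferBarRelIdx L klEngGeoTh P (klCT8 P R (klEngQ7 P R)
                  klEngGeo14 klEngGeoTh) β U (n - 1) (n - 1) Qm x y + 3 / 2 * (3 / 2 * m) * ∑ t, transferBarRelIdx L klEngGeoTh P (klCT8 P R (klEngQ7 P R) klEngGeo14 klEngGeoTh) β U (n - 1) (n - 1) Qm x t * |w₁ t| + 3 / 2 * (3 / 2 * m + r') * ∑ a, |w₁ a| * transferBarRelIdx L klEngGeoTh P (klCT8 P R (klEngQ7 P R)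
                  klEngGeo14 klEngGeoTh) β U (n - 1) (n - 1) Qm a y + 9 / 4 * (3 / 2 * m + r') * (3 / 2 * m) * ∑ a, ∑ t, |w₁ a| * transferBarRelIdx L klEngGeoTh P (klCT8 P R (klEngQ7 P R) klEngGeo14 klEngGeoTh) β U (n - 1) (n - 1) Qm a t * |w₁ t|) ≤ E₁ x y) ∧ (∀ x y, E₁ x y ≤ e₁) ∧ (3 / 2 * m + r') * ∑ a, |w₁ a| ≤ 1 /
                  3 ∧ (∑ p, |w₁ p| ≤ 3 / 4 * klEngGeo14.bhi) ∧ (∑ p, (|w₁ p| - w₁ p) ≤ klEdge klEngGeo14 n (klTorusNorm L Qm)) ∧ (∀ k ∈ klBall L μ 0, ∀ k' ∈ klBall L μ 0, E₁ k k' ≤ drivePBar klEngGeo14 P U (n - 1) + eremBar klEngGeo14 P (klEngQ9dG klEngGeo14 P R) U β L (n - 1) + thermalBar klEngGeo14 P U β n +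
                  legDressBarQ2 klEngGeo14 P (klEngQ9dG klEngGeo14 P R) U n (legSliceCountT L β μ (klFlowFrameU L M β U μ n) n ![k', Qm - k', Qm - k, k]) + (P.Klam * U) ^ 2 * (klEngGeo14.phGain n (klTorusNorm L (k - k')) + klEngGeo14.phGain n (klTorusNorm L (k + k' - Qm))) + frameShiftBar P (klEngQ9dG klEngGeo14 P R)
                  U n)) := by
  intro P R c hP hR hc hc3 μ hμ U hU hUle β hβ hβc L M _ _ hL hM n hn1 hn hreg hhist hfr hV4 hlev hlevU hiso htr
  obtain ⟨n', rfl⟩ : ∃ n', n = n' + 1 := ⟨n - 1, by omega⟩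
  obtain ⟨m, hm, hC₀, hsm₀, hZ, htow⟩ :=
    hexLadMD P R c hP hR hc hc3 μ hμ U hU hUle β hβ hβc L M hL hM (n' + 1) hn1 hn hreg hhist hfr hV4 hlev hlevU hiso htr n' rfl
  clear hexLadMD
  have hβL : β ≤ (L : ℝ) := le_of_klEngL₄_le hL
  have hG : (2 : ℝ) ^ 19 ≤ klEngGeo14.bhi := by rw [klEngGeo14_bhi_eq]; norm_num
  have hm7 : 3 / 2 * m * 738288 ≤ 1 / 3 := by
    have h := hsm₀; rw [klEngGeo14_bhi_eq] at h; norm_num at h; linarith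
  -- C4a chart / frame / Matsubara data UNDER ROW (c)'s DOORS (`rowC_frameWindow` lineage): `B := bandBounds(−6/5,−1/10)`, `Af := 2Gfr₀|U| + 2Gfr₁U² + Gfr₂·c/log 4 ≤ 1/240`,
  -- window radius `r := 4Λ_(n'+1) + 3Af + 1/2000` (room: `μ ≤ −0.15`, `4Λ_(n'+1) ≤ 1/32`, `4Af ≤ 1/60`; lattice margin `(4+2Af)·2π/L ≤ 2⁻¹⁹` from `L ≥ 1024β² ≥ 2²⁴`)
  obtain ⟨hAf, -, -, -, -, -, hMbox⟩ := rowC_frameWindow klEngGeo14 hR hc hc3 hμ hU hUle hβ hβc hM hfr n'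
  have hGfr : ∀ j, 0 ≤ R.Gfr j := hR.1.2.2
  have hc33 : c ≤ klEngC₃3 P R := (hc3.trans (klEngC₃7GU_le_klEngC₃6 klEngGeo14 P R)).trans (klEngC₃6_le_klEngC₃3 P R)
  have hU3 : U ≤ klEngU₀3 P R c := hUle.trans (klEngU₀12GQ_le_klEngU₀3 klEngGeo14 (klEngQ9dG klEngGeo14 P R) P R c)
  obtain ⟨hcle, hUle'⟩ := frameWindow_thresholds_of_doors (P := P) hR hc33 hU3
  have hAf240 : (2 * R.Gfr 0 * |U| + 2 * R.Gfr 1 * U ^ 2 + R.Gfr 2 * (c / Real.log 4)) ≤ 1 / 240 := by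
    have h := frameSize_le_of_thresholds hGfr hc hcle hU hUle'
    have hκ : min ((bandBounds (show (-4 : ℝ) < -(6 / 5) by norm_num) (show (-(6 / 5) : ℝ) ≤ -(1 / 10) by norm_num) (show (-(1 / 10) : ℝ) < 0 by norm_num)).Dtmin / 4) (1 / 40) ≤ 1 / 40 := min_le_right _ _
    linarith
  have hAf0 : 0 ≤ (2 * R.Gfr 0 * |U| + 2 * R.Gfr 1 * U ^ 2 + R.Gfr 2 * (c / Real.log 4)) := le_trans (norm_nonneg _) (hAf 0 0 (by norm_num))
  have hDt : (33 : ℝ) / 100 ≤ (bandBounds (show (-4 : ℝ) < -(6 / 5) by norm_num) (show (-(6 / 5) : ℝ) ≤ -(1 / 10) by norm_num) (show (-(1 / 10) : ℝ) < 0 by norm_num)).Dtmin := cDtmin_engineWindow_ge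
  have hADt : 2 * (2 * R.Gfr 0 * |U| + 2 * R.Gfr 1 * U ^ 2 + R.Gfr 2 * (c / Real.log 4)) < (bandBounds (show (-4 : ℝ) < -(6 / 5) by norm_num) (show (-(6 / 5) : ℝ) ≤ -(1 / 10) by norm_num) (show (-(1 / 10) : ℝ) < 0 by norm_num)).Dtmin := by linarith
  have hΛ32 : 4 * klScale klE0 (n' + 1) ≤ 1 / 32 := by
    have hsc : klScale klE0 (n' + 1) = klE0 * ((4 : ℝ) ^ (n' + 1))⁻¹ := rfl
    have he0 : klE0 = 1 / 32 := rfl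
    have h4 : (4 : ℝ) ≤ (4 : ℝ) ^ (n' + 1) := by
      calc (4 : ℝ) = 4 ^ 1 := by norm_num
        _ ≤ 4 ^ (n' + 1) := pow_le_pow_right₀ (by norm_num) (by omega)
    have hinv : ((4 : ℝ) ^ (n' + 1))⁻¹ ≤ 1 / 4 := by rw [one_div]; exact inv_anti₀ (by norm_num) h4
    rw [hsc, he0]
    nlinarith only [hinv]
  have hμlo : (-1.05 : ℝ) ≤ μ := hμ.1
  have hμhi : μ ≤ (-0.15 : ℝ) := hμ.2
  have hlo : (-(6 / 5) : ℝ) < μ - (4 * klScale klE0 (n' + 1) + 3 * (2 * R.Gfr 0 * |U| + 2 * R.Gfr 1 * U ^ 2 + R.Gfr 2 * (c / Real.log 4)) + 1 / 2000) - (2 * R.Gfr 0 * |U| + 2 * R.Gfr 1 * U ^ 2 + R.Gfr 2 * (c / Real.log 4)) := by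
    norm_num at hμlo ⊢; linarith
  have hhi : μ + (4 * klScale klE0 (n' + 1) + 3 * (2 * R.Gfr 0 * |U| + 2 * R.Gfr 1 * U ^ 2 + R.Gfr 2 * (c / Real.log 4)) + 1 / 2000) + (2 * R.Gfr 0 * |U| + 2 * R.Gfr 1 * U ^ 2 + R.Gfr 2 * (c / Real.log 4)) < -(1 / 10) := by
    norm_num at hμhi ⊢; linarith
  have hβ0 : 0 < β := KLRegimeSplit.pos_of_klBetaMin_le hβ
  have hβ128 : (128 : ℝ) ≤ β := le_trans (by norm_num [klBetaMin]) hβ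
  have hL24 : (2 : ℝ) ^ 24 ≤ (L : ℝ) := by
    have h3 : (klEngL₃ β U : ℝ) ≤ (L : ℝ) := by exact_mod_cast klEngL₃_le_of_klEngL₄_le hL
    have hsq : 1024 * β ^ 2 ≤ (klEngL₃ β U : ℝ) := sq_beta_le_klEngL₃ β U
    nlinarith
  have hLpos : (0 : ℝ) < L := lt_of_lt_of_le (by norm_num) hL24
  have hmargin : (4 + 2 * (2 * R.Gfr 0 * |U| + 2 * R.Gfr 1 * U ^ 2 + R.Gfr 2 * (c / Real.log 4))) * (2 * π / L) < 1 / 2000 := by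
    have hπ4 := Real.pi_lt_four
    have h1 : (4 + 2 * (2 * R.Gfr 0 * |U| + 2 * R.Gfr 1 * U ^ 2 + R.Gfr 2 * (c / Real.log 4))) * (2 * π / L) ≤ (4 + 2 * (1 / 240)) * (8 / L) := by
      have h8 : 2 * π / L ≤ 8 / L := div_le_div_of_nonneg_right (by linarith) hLpos.le
      have hπL : 0 ≤ 2 * π / L := by positivity
      exact mul_le_mul (by linarith) h8 hπL (by norm_num)
    have h2 : (4 + 2 * (1 / 240)) * (8 / (L : ℝ)) < 1 / 2000 := by
      rw [mul_div_assoc', div_lt_iff₀ hLpos]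
      nlinarith
    linarith
  have hΛr : ∀ t ∈ Icc (0 : ℝ) 1, (klScale klE0 n' + t * (klScale klE0 (n' + 1) - klScale klE0 n')) + (4 + 2 * (2 * R.Gfr 0 * |U| + 2 * R.Gfr 1 * U ^ 2 + R.Gfr 2 * (c / Real.log 4))) * (2 * π / L) < 4 * klScale klE0 (n' + 1) + 3 * (2 * R.Gfr 0 * |U| + 2 * R.Gfr 1 * U ^ 2 + R.Gfr 2 * (c / Real.log 4)) + 1 / 2000 := by
    intro t ht
    have h1 := (scaleAt_mem n' ht).2
    have h2 : klScale klE0 n' = 4 * klScale klE0 (n' + 1) := by rw [klth_klScale_succ n']; ring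
    linarith
  have hMt : ∀ t ∈ Icc (0 : ℝ) 1, β * (klScale klE0 n' + t * (klScale klE0 (n' + 1) - klScale klE0 n')) / (2 * Real.pi) + 1 ≤ M := by
    intro t ht
    have h1 := (scaleAt_mem n' ht).2
    have h2 : klScale klE0 n' = 4 * klScale klE0 (n' + 1) := by rw [klth_klScale_succ n']; ring
    have h3 : β * (klScale klE0 n' + t * (klScale klE0 (n' + 1) - klScale klE0 n')) / (2 * Real.pi) ≤ β * (4 * klScale klE0 (n' + 1)) / (2 * Real.pi) :=
      div_le_div_of_nonneg_right (mul_le_mul_of_nonneg_left (by linarith) hβ0.le) (by positivity)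
    linarith
  simp only [Nat.add_sub_cancel]
  -- the generic package at row (c)'s bar / slot (pins instantiated by `rfl`), THEN the rows package: two first-order steps (one nested `exact` is a whnf cliff)
  have K := klmt_htower_family_sigmaData L M hm hm7 hfr hβ hβL hG hZ _ _ _ _ _ _ _ _ _ _ _ _ rfl rfl rfl rfl rfl rfl rfl rfl rfl rfl rfl rfl
    (bandBounds (show (-4 : ℝ) < -(6 / 5) by norm_num) (show (-(6 / 5) : ℝ) ≤ -(1 / 10) by norm_num) (show (-(1 / 10) : ℝ) < 0 by norm_num)) hAf hADt hlo hhi hΛr hMt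
    (fun Qm x y => transferBarRelIdx L klEngGeoTh P (klCT8 P R (klEngQ7 P R) klEngGeo14 klEngGeoTh) β U n' n' Qm x y)
    (fun Qm k k' => drivePBar klEngGeo14 P U n' + eremBar klEngGeo14 P (klEngQ9dG klEngGeo14 P R) U β L n' + thermalBar klEngGeo14 P U β (n' + 1) +
              legDressBarQ2 klEngGeo14 P (klEngQ9dG klEngGeo14 P R) U (n' + 1) (legSliceCountT L β μ (klFlowFrameU L M β U μ (n' + 1)) (n' + 1) ![k', Qm - k', Qm - k, k]) +
              (P.Klam * U) ^ 2 * (klEngGeo14.phGain (n' + 1) (klTorusNorm L (k - k')) + klEngGeo14.phGain (n' + 1) (klTorusNorm L (k + k' - Qm))) +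
              frameShiftBar P (klEngQ9dG klEngGeo14 P R) U (n' + 1))
  have H := htow _ _ _ _ _ _ _ _ _ _ _ _ rfl rfl rfl rfl rfl rfl rfl rfl rfl rfl rfl rfl
  exact ⟨m, hm, hC₀, hsm₀, K H⟩

end LadTowerMD

end Summit.HubbardSuperconductivity.HubbardSuperconductivity.Theorems.EngineV8

end
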